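import Summits.KontsevichZagierPeriods.KontsevichZagierPeriods.Theorems.SoloInformedKZStokesSimplexFaces
import HarnessLib

/-!
# SoloInformed — KZ–Stokes on the cube: Ayoub's Stokes generators are KZ relations

In Ayoub's form of the Kontsevich–Zagier period conjecture the algebra of periods is presented by
symbols `[f]`, `f` a function on a closed unit cube `[0,1]ⁿ` (algebraic power series convergent near
the cube), and the ideal of "obvious relations" is generated by (a) the compatibilities
`[f ∘ init] = [f]` and (b) the *Stokes elements* `[∂f/∂zᵢ] − [f|_{zᵢ=1}] + [f|_{zᵢ=0}]`
[Ayoub 2014, EMS Newsl. 91, §2; Ayoub 2015, Ann. of Math. 181].  Both kinds of generators are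
`ℤ`-combinations of the three Kontsevich–Zagier moves, for every real-valued `g` which is
`ℚ`-semialgebraic and `C¹` on an open neighbourhood of the cube (`soloInformed_kzStokes_cube`), resp.
for every admissible integrand (`soloInformed_of_sub_of_comp_init_mem_relations`).  This is the cube
half of the engine of THEOREM D (transfer of the Ayoub/Nori form of the period conjecture to
`KZPeriodConjecture`) of the solo-informed programme; the simplex half is
`soloInformed_kzStokes_simplex`.  Method: the coordinate permutation `Pᵢ` (a change of variables with
`|det| = 1` by the volume trick for any set of positive finite volume,
`soloInformed_of_sub_of_affine_mem_relations'`), one Newton–Leibniz move along the last coordinate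
over the base cube, integrand additivity.
-/

noncomputable section

open scoped BigOperators
open Set MeasureTheory
open Literature.NumberTheory.Transcendental Literature.NumberTheory.Transcendental.KZ
open Literature.ModelTheory.ExponentialFields (IsSemialgebraic isSemialgebraic_setOf_eval_le)

namespace Summit.KontsevichZagierPeriods.KontsevichZagierPeriods.Theorems

/-! ### The unit cube -/

/-- The closed unit cube `[0,1]ᵏ = {z | 0 ≤ zⱼ ≤ 1 for all j}`. -/
def soloInformedCube (k : ℕ) : Set (Fin k → ℝ) := {z | ∀ j, 0 ≤ z j ∧ z j ≤ 1}

/-- Membership in the cube. -/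
theorem soloInformed_mem_cube_iff {k : ℕ} {z : Fin k → ℝ} :
    z ∈ soloInformedCube k ↔ ∀ j, 0 ≤ z j ∧ z j ≤ 1 := Iff.rfl

/-- The cube is the order interval `Icc 0 1` of `ℝᵏ`. -/
theorem soloInformedCube_eq_Icc (k : ℕ) : soloInformedCube k = Icc 0 1 := by
  ext z
  simp only [soloInformed_mem_cube_iff, mem_Icc, Pi.le_def, Pi.zero_apply, Pi.one_apply, forall_and]

/-- The cube is `ℚ`-semialgebraic. [BCR 1998, §2.1] -/
theorem isSemialgebraic_soloInformedCube (k : ℕ) : IsSemialgebraic ℚ (soloInformedCube k) := by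
  have h1 : IsSemialgebraic ℚ (⋂ i ∈ (Finset.univ : Finset (Fin k)), {t : Fin k → ℝ | 0 ≤ t i}) :=
    IsSemialgebraic.biInter Finset.univ _ fun i _ => by
      simpa using isSemialgebraic_setOf_eval_le (k := ℚ) (R := ℝ) (0 : MvPolynomial (Fin k) ℚ)
        (MvPolynomial.X i)
  have h2 : IsSemialgebraic ℚ (⋂ i ∈ (Finset.univ : Finset (Fin k)), {t : Fin k → ℝ | t i ≤ 1}) :=
    IsSemialgebraic.biInter Finset.univ _ fun i _ => by
      simpa using isSemialgebraic_setOf_eval_le (k := ℚ) (R := ℝ)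
        (MvPolynomial.X i : MvPolynomial (Fin k) ℚ) 1
  have hset : soloInformedCube k = (⋂ i ∈ (Finset.univ : Finset (Fin k)), {t : Fin k → ℝ | 0 ≤ t i}) ∩
      ⋂ i ∈ (Finset.univ : Finset (Fin k)), {t : Fin k → ℝ | t i ≤ 1} := by
    ext t
    simp [soloInformedCube, forall_and]
  rw [hset]
  exact h1.inter h2

/-- The cube is compact. -/
theorem isCompact_soloInformedCube (k : ℕ) : IsCompact (soloInformedCube k) := by
  rw [soloInformedCube_eq_Icc]; exact isCompact_Icc

/-- The cube has volume `1`. -/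
theorem volume_soloInformedCube (k : ℕ) : volume (soloInformedCube k) = 1 := by
  rw [soloInformedCube_eq_Icc, Real.volume_Icc_pi]; simp

/-- The representation `[[0,1]ᵏ, f]` for a `ℚ`-semialgebraic `f` continuous on the cube. -/
def soloInformedCubeRep (k : ℕ) (f : (Fin k → ℝ) → ℝ)
    (hs : IsSemialgebraicFunOn ℚ (soloInformedCube k) f)
    (hc : ContinuousOn f (soloInformedCube k)) : IntegralRep k :=
  ⟨soloInformedCube k, f, isSemialgebraic_soloInformedCube k, hs,
    hc.integrableOn_compact (isCompact_soloInformedCube k)⟩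

/-- Domain of `soloInformedCubeRep`. -/
@[simp] theorem soloInformedCubeRep_domain (k : ℕ) (f : (Fin k → ℝ) → ℝ)
    (hs : IsSemialgebraicFunOn ℚ (soloInformedCube k) f) (hc : ContinuousOn f (soloInformedCube k)) :
    (soloInformedCubeRep k f hs hc).domain = soloInformedCube k := rfl

/-- Integrand of `soloInformedCubeRep`. -/
@[simp] theorem soloInformedCubeRep_integrand (k : ℕ) (f : (Fin k → ℝ) → ℝ)
    (hs : IsSemialgebraicFunOn ℚ (soloInformedCube k) f) (hc : ContinuousOn f (soloInformedCube k)) :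
    (soloInformedCubeRep k f hs hc).integrand = f := rfl

/-! ### Affine automorphisms of a set of positive finite volume are change-of-variables moves -/

/-- **Volume trick**: if `Φ = c + L` maps a set `s` with `0 < vol s < ∞` onto itself, `|det L| = 1`. -/
theorem soloInformed_abs_det_eq_one_of_image_eq {k : ℕ} (L : (Fin k → ℝ) →L[ℝ] (Fin k → ℝ))
    (c : Fin k → ℝ) {Φ : (Fin k → ℝ) → (Fin k → ℝ)} (hΦ : ∀ x, Φ x = c + L x) {s : Set (Fin k → ℝ)}
    (hs0 : volume s ≠ 0) (hs1 : volume s ≠ ⊤) (himage : Φ '' s = s) : |L.det| = 1 := by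
  have hΦ' : Φ = (fun y => c + y) ∘ L := funext fun x => by simp [hΦ x]
  have h1 : volume (Φ '' s) = ENNReal.ofReal |L.det| * volume s := by
    rw [hΦ', Set.image_comp, Set.image_add_left, measure_preimage_add,
      Measure.addHaar_image_continuousLinearMap]
  rw [himage] at h1
  have h2 : volume s * ENNReal.ofReal |L.det| = volume s * 1 := by
    rw [mul_one, mul_comm]
    exact h1.symm
  rw [ENNReal.mul_right_inj hs0 hs1, ENNReal.ofReal_eq_one] at h2
  exact h2

/-- **Affine automorphisms are change-of-variables moves, general form**: `Φ = c + L` semialgebraic,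
injective on `s` (`0 < vol s < ∞`), `Φ '' s = s`, `f = f' ∘ Φ` on `s` ⟹ `[s, f] − [s, f'] ∈ KZ.relations`
(rule (2) with `|det L| = 1`). [Kontsevich–Zagier 2001, §1.2 rule (2)] -/
theorem soloInformed_of_sub_of_affine_mem_relations' {k : ℕ} (L : (Fin k → ℝ) →L[ℝ] (Fin k → ℝ))
    (c : Fin k → ℝ) {Φ : (Fin k → ℝ) → (Fin k → ℝ)} (hΦ : ∀ x, Φ x = c + L x) {s : Set (Fin k → ℝ)}
    (hs0 : volume s ≠ 0) (hs1 : volume s ≠ ⊤) (hsa : IsSemialgebraicMapOn ℚ s Φ) (hinj : InjOn Φ s)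
    (himage : Φ '' s = s) (r r' : IntegralRep k) (hr : r.domain = s) (hr' : r'.domain = s)
    (h : ∀ x ∈ s, r.integrand x = r'.integrand (Φ x)) : of r - of r' ∈ relations := by
  have hdet : |L.det| = 1 := soloInformed_abs_det_eq_one_of_image_eq L c hΦ hs0 hs1 himage
  have hΦ' : Φ = fun x => c + L x := funext hΦ
  have hderiv : ∀ x ∈ r.domain,
      HasFDerivWithinAt Φ (L : (Fin k → ℝ) →L[ℝ] (Fin k → ℝ)) r.domain x := fun x _ => by
    rw [hΦ']
    exact (L.hasFDerivAt.const_add c).hasFDerivWithinAt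
  refine changeOfVariablesRel_subset_relations ⟨k, r, r', Φ, fun _ => L, by rw [hr]; exact hsa,
    hderiv, by rw [hr]; exact hinj, by rw [hr', hr, himage], fun x hx => ?_, rfl⟩
  show r.integrand x = r'.integrand (Φ x) * |L.det|
  rw [hdet, mul_one]
  exact h x (hr ▸ hx)

/-! ### The coordinate permutation on the cube -/

/-- `Pᵢ` maps the cube into itself. -/
theorem soloInformedFacePerm_mem_cube {m : ℕ} (i : Fin (m + 1)) {z : Fin (m + 1) → ℝ}
    (hz : z ∈ soloInformedCube (m + 1)) : soloInformedFacePerm i z ∈ soloInformedCube (m + 1) :=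
  fun _ => hz _

/-- The inverse of `Pᵢ` maps the cube into itself. -/
theorem soloInformed_snoc_removeNth_mem_cube {m : ℕ} (i : Fin (m + 1)) {w : Fin (m + 1) → ℝ}
    (hw : w ∈ soloInformedCube (m + 1)) :
    (Fin.snoc (Fin.removeNth i w) (w i) : Fin (m + 1) → ℝ) ∈ soloInformedCube (m + 1) := by
  rw [soloInformed_mem_cube_iff, Fin.forall_fin_succ']
  exact ⟨fun k => by simpa [Fin.removeNth] using hw (i.succAbove k), by simpa using hw i⟩

/-- `Pᵢ` maps the cube onto itself. -/
theorem soloInformedFacePerm_image_cube {m : ℕ} (i : Fin (m + 1)) :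
    soloInformedFacePerm i '' soloInformedCube (m + 1) = soloInformedCube (m + 1) :=
  Subset.antisymm (image_subset_iff.2 fun _ hz => soloInformedFacePerm_mem_cube i hz)
    fun w hw => ⟨_, soloInformed_snoc_removeNth_mem_cube i hw, soloInformedFacePerm_snoc_removeNth i w⟩

/-- **Band description**: `[0,1]ᵐ⁺¹` is the band `0 ≤ t ≤ 1` over `[0,1]ᵐ` (last coordinate). -/
theorem soloInformedCube_succ_eq_band (m : ℕ) :
    soloInformedCube (m + 1) =
      {z : Fin (m + 1) → ℝ | Fin.init z ∈ soloInformedCube m ∧ 0 ≤ z (Fin.last m) ∧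
        z (Fin.last m) ≤ 1} := by
  ext z
  rw [soloInformed_mem_cube_iff, Fin.forall_fin_succ']
  exact Iff.rfl

/-- Points of the fibres of the band lie in the cube. -/
theorem soloInformed_insertNth_mem_cube {m : ℕ} (i : Fin (m + 1)) {s : Fin m → ℝ}
    (hs : s ∈ soloInformedCube m) {t : ℝ} (ht0 : 0 ≤ t) (ht1 : t ≤ 1) :
    (Fin.insertNth i t s : Fin (m + 1) → ℝ) ∈ soloInformedCube (m + 1) :=
  (Fin.forall_iff_succAbove i).2 ⟨by simpa using And.intro ht0 ht1, fun k => by simpa using hs k⟩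

/-- The facet maps `s ↦ insertNth i q s` (`q` rational) are semialgebraic maps. -/
theorem soloInformed_isSemialgebraicMapOn_insertNth_const {m : ℕ} {s : Set (Fin m → ℝ)}
    (hs : IsSemialgebraic ℚ s) (i : Fin (m + 1)) (q : ℚ) :
    IsSemialgebraicMapOn ℚ s (fun x : Fin m → ℝ => (Fin.insertNth i (q : ℝ) x : Fin (m + 1) → ℝ)) :=
  IsSemialgebraicMapOn.of_forall hs fun j =>
    soloInformed_isSemialgebraicFunOn_insertNth_apply hs (φ := fun _ => (q : ℝ))
      (isSemialgebraicFunOn_ratCast hs q) i j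

/-- The facet map `s ↦ insertNth i 0 s` is a semialgebraic map. -/
theorem soloInformed_isSemialgebraicMapOn_insertNth_zero {m : ℕ} {s : Set (Fin m → ℝ)}
    (hs : IsSemialgebraic ℚ s) (i : Fin (m + 1)) :
    IsSemialgebraicMapOn ℚ s (fun x : Fin m → ℝ => (Fin.insertNth i (0 : ℝ) x : Fin (m + 1) → ℝ)) := by
  simpa using soloInformed_isSemialgebraicMapOn_insertNth_const hs i 0

/-- The facet map `s ↦ insertNth i 1 s` is a semialgebraic map. -/
theorem soloInformed_isSemialgebraicMapOn_insertNth_one {m : ℕ} {s : Set (Fin m → ℝ)}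
    (hs : IsSemialgebraic ℚ s) (i : Fin (m + 1)) :
    IsSemialgebraicMapOn ℚ s (fun x : Fin m → ℝ => (Fin.insertNth i (1 : ℝ) x : Fin (m + 1) → ℝ)) := by
  simpa using soloInformed_isSemialgebraicMapOn_insertNth_const hs i 1

/-- The facet maps `s ↦ insertNth i c s` are continuous. -/
theorem soloInformed_continuous_insertNth_const {m : ℕ} (i : Fin (m + 1)) (c : ℝ) :
    Continuous fun x : Fin m → ℝ => (Fin.insertNth i c x : Fin (m + 1) → ℝ) :=
  (continuous_const : Continuous fun _ : Fin m → ℝ => c).finInsertNth i continuous_id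

/-! ### Ayoub's Stokes generator is a KZ relation -/

/-- **KZ–Stokes on the cube (Ayoub's Stokes generator).**  For `g` `ℚ`-semialgebraic and `C¹` on
an open `W ⊇ [0,1]ᵐ⁺¹` and any `i`: `[[0,1]ᵐ⁺¹, ∂ᵢ g] − ([[0,1]ᵐ, g(insertNth i 1 ·)] −
[[0,1]ᵐ, g(insertNth i 0 ·)]) ∈ KZ.relations` — Ayoub's generator `∂g/∂zᵢ − g|_{zᵢ=1} + g|_{zᵢ=0}`
is a `ℤ`-combination of a change of variables (`Pᵢ`), one Newton–Leibniz move and integrand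
additivity. [Ayoub 2014, §2.2; Kontsevich–Zagier 2001, §1.2] -/
theorem soloInformed_kzStokes_cube {m : ℕ} {W : Set (Fin (m + 1) → ℝ)} (hW : IsOpen W)
    (hCW : soloInformedCube (m + 1) ⊆ W) {g : (Fin (m + 1) → ℝ) → ℝ}
    (hgs : IsSemialgebraicFunOn ℚ W g) (hgd : ContDiffOn ℝ 1 g W) (i : Fin (m + 1))
    (rD : IntegralRep (m + 1)) (hDd : rD.domain = soloInformedCube (m + 1))
    (hDi : EqOn rD.integrand (fun z => fderiv ℝ g z (Pi.single i 1)) (soloInformedCube (m + 1)))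
    (rT rB : IntegralRep m) (hTd : rT.domain = soloInformedCube m)
    (hBd : rB.domain = soloInformedCube m)
    (hTi : EqOn rT.integrand (fun s => g (Fin.insertNth i 1 s)) (soloInformedCube m))
    (hBi : EqOn rB.integrand (fun s => g (Fin.insertNth i 0 s)) (soloInformedCube m)) :
    of rD - (of rT - of rB) ∈ relations := by
  have hC := isSemialgebraic_soloInformedCube (m + 1)
  have hC' := isSemialgebraic_soloInformedCube m
  have hd : ∀ z ∈ W, DifferentiableAt ℝ g z := fun z hz =>
    (hgd.differentiableOn one_ne_zero z hz).differentiableAt (hW.mem_nhds hz)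
  have hc : ContinuousOn g W := hgd.continuousOn
  have hgsC : IsSemialgebraicFunOn ℚ (soloInformedCube (m + 1)) g := hgs.mono hCW hC
  have hDs : IsSemialgebraicFunOn ℚ (soloInformedCube (m + 1))
      (fun z => fderiv ℝ g z (Pi.single i 1)) := (hgs.fderiv_apply_single hW hd i).mono hCW hC
  have hDc : ContinuousOn (fun z => fderiv ℝ g z (Pi.single i 1)) (soloInformedCube (m + 1)) :=
    ((hgd.continuousOn_fderiv_of_isOpen hW le_rfl).clm_apply continuousOn_const).mono hCW
  have hPs := soloInformed_isSemialgebraicMapOn_facePerm i hC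
  have hPm : MapsTo (soloInformedFacePerm i) (soloInformedCube (m + 1)) (soloInformedCube (m + 1)) :=
    fun z hz => soloInformedFacePerm_mem_cube i hz
  have hPc : Continuous (soloInformedFacePerm i) := (soloInformedFacePermCLM i).continuous
  have hfib : ∀ s ∈ soloInformedCube m, ∀ t ∈ Icc (0 : ℝ) 1,
      (Fin.insertNth i t s : Fin (m + 1) → ℝ) ∈ soloInformedCube (m + 1) :=
    fun s hs t ht => soloInformed_insertNth_mem_cube i hs ht.1 ht.2
  -- facet integrands
  have hTs : IsSemialgebraicFunOn ℚ (soloInformedCube m) (fun s => g (Fin.insertNth i 1 s)) :=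
    IsSemialgebraicFunOn.comp_isSemialgebraicMapOn_holds hgsC
      (soloInformed_isSemialgebraicMapOn_insertNth_one hC' i)
      fun s hs => hfib s hs 1 ⟨zero_le_one, le_rfl⟩
  have hTc : ContinuousOn (fun s => g (Fin.insertNth i 1 s)) (soloInformedCube m) :=
    hc.comp (soloInformed_continuous_insertNth_const i 1).continuousOn
      fun s hs => hCW (hfib s hs 1 ⟨zero_le_one, le_rfl⟩)
  have hBs : IsSemialgebraicFunOn ℚ (soloInformedCube m) (fun s => g (Fin.insertNth i 0 s)) :=
    IsSemialgebraicFunOn.comp_isSemialgebraicMapOn_holds hgsC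
      (soloInformed_isSemialgebraicMapOn_insertNth_zero hC' i)
      fun s hs => hfib s hs 0 ⟨le_rfl, zero_le_one⟩
  have hBc : ContinuousOn (fun s => g (Fin.insertNth i 0 s)) (soloInformedCube m) :=
    hc.comp (soloInformed_continuous_insertNth_const i 0).continuousOn
      fun s hs => hCW (hfib s hs 0 ⟨le_rfl, zero_le_one⟩)
  -- (1) relabel coordinates
  let AP : IntegralRep (m + 1) := soloInformedCubeRep (m + 1)
    (fun z => fderiv ℝ g (soloInformedFacePerm i z) (Pi.single i 1))
    (IsSemialgebraicFunOn.comp_isSemialgebraicMapOn_holds hDs hPs hPm)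
    (hDc.comp hPc.continuousOn hPm)
  have h1 : of AP - of rD ∈ relations :=
    soloInformed_of_sub_of_affine_mem_relations' (soloInformedFacePermCLM i) 0 (fun z => by simp)
      (by rw [volume_soloInformedCube]; exact one_ne_zero)
      (by rw [volume_soloInformedCube]; exact ENNReal.one_ne_top) hPs
      (soloInformedFacePerm_injective i).injOn (soloInformedFacePerm_image_cube i) AP rD rfl hDd
      fun z hz => by
        show fderiv ℝ g (soloInformedFacePerm i z) (Pi.single i 1) =
          rD.integrand (soloInformedFacePerm i z)
        rw [hDi (soloInformedFacePerm_mem_cube i hz)]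
  -- (2) Newton–Leibniz along the last coordinate
  let Base : IntegralRep m := soloInformedCubeRep m
    (fun s => g (Fin.insertNth i 1 s) - g (Fin.insertNth i 0 s))
    (IsSemialgebraicFunOn.sub_holds hTs hBs) (hTc.sub hBc)
  have h2 : of AP - of Base ∈ relations := by
    refine newtonLeibnizRel_subset_relations ⟨m, AP, Base, fun _ => 0, fun _ => 1,
      fun z => g (soloInformedFacePerm i z), ?_, ?_, ?_, ?_, soloInformedCube_succ_eq_band m,
      ?_, ?_, ?_, rfl⟩
    · exact IsSemialgebraicFunOn.comp_isSemialgebraicMapOn_holds hgsC hPs hPm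
    · exact (by simpa using isSemialgebraicFunOn_ratCast hC' 0 :
        IsSemialgebraicFunOn ℚ (soloInformedCube m) fun _ : Fin m → ℝ => (0 : ℝ))
    · exact (by simpa using isSemialgebraicFunOn_ratCast hC' 1 :
        IsSemialgebraicFunOn ℚ (soloInformedCube m) fun _ : Fin m → ℝ => (1 : ℝ))
    · exact fun _ _ => zero_le_one
    · intro s hs
      have hs' : s ∈ soloInformedCube m := hs
      show ContinuousOn (fun t : ℝ => g (soloInformedFacePerm i (Fin.snoc s t))) (Icc 0 1)
      simp only [soloInformedFacePerm_snoc]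
      exact hc.comp (soloInformed_continuous_insertNth i s).continuousOn
        fun t ht => hCW (hfib s hs' t ht)
    · intro s hs t ht
      have hs' : s ∈ soloInformedCube m := hs
      have ht' : t ∈ Ioo (0 : ℝ) 1 := ht
      have hzW : (Fin.insertNth i t s : Fin (m + 1) → ℝ) ∈ W :=
        hCW (hfib s hs' t (Ioo_subset_Icc_self ht'))
      show HasDerivAt (fun u : ℝ => g (soloInformedFacePerm i (Fin.snoc s u)))
        (fderiv ℝ g (soloInformedFacePerm i (Fin.snoc s t)) (Pi.single i 1)) t
      simp only [soloInformedFacePerm_snoc]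
      exact (hd _ hzW).hasFDerivAt.comp_hasDerivAt t (soloInformed_hasDerivAt_insertNth i s t)
    · intro s _
      show g (Fin.insertNth i 1 s) - g (Fin.insertNth i 0 s) =
        g (soloInformedFacePerm i (Fin.snoc s 1)) - g (soloInformedFacePerm i (Fin.snoc s 0))
      rw [soloInformedFacePerm_snoc, soloInformedFacePerm_snoc]
  -- (3) split the base integrand
  let N : IntegralRep m :=
    soloInformedCubeRep m (fun s => -g (Fin.insertNth i 0 s)) hBs.neg hBc.neg
  have h3 : of Base - of rT - of N ∈ relations :=
    integrandAddRel_subset_relations ⟨m, Base, rT, N, by rw [hTd]; rfl, rfl, fun s hs => by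
      have hs' : s ∈ soloInformedCube m := hs
      show g (Fin.insertNth i 1 s) - g (Fin.insertNth i 0 s) = rT.integrand s + -g (Fin.insertNth i 0 s)
      rw [hTi hs']
      ring, rfl⟩
  have h4 : of N + of rB ∈ relations :=
    of_add_of_mem_relations_of_eqOn_neg (r := N) (r' := rB) (by rw [hBd]; rfl) fun s hs => by
      have hs' : s ∈ soloInformedCube m := hs
      rw [hBi hs']
      show g (Fin.insertNth i 0 s) = -(-g (Fin.insertNth i 0 s))
      rw [neg_neg]
  have key : of rD - (of rT - of rB) =
      -(of AP - of rD) + (of AP - of Base) + (of Base - of rT - of N) + (of N + of rB) := by abel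
  rw [key]
  exact relations.add_mem (relations.add_mem (relations.add_mem (relations.neg_mem h1) h2) h3) h4

/-- **Existence of the three representations**: `soloInformed_kzStokes_cube` is not vacuous. -/
theorem soloInformed_kzStokes_cube_exists {m : ℕ} {W : Set (Fin (m + 1) → ℝ)} (hW : IsOpen W)
    (hCW : soloInformedCube (m + 1) ⊆ W) {g : (Fin (m + 1) → ℝ) → ℝ}
    (hgs : IsSemialgebraicFunOn ℚ W g) (hgd : ContDiffOn ℝ 1 g W) (i : Fin (m + 1)) :
    ∃ (rD : IntegralRep (m + 1)) (rT rB : IntegralRep m),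
      rD.domain = soloInformedCube (m + 1) ∧
      (rD.integrand = fun z => fderiv ℝ g z (Pi.single i 1)) ∧
      rT.domain = soloInformedCube m ∧ (rT.integrand = fun s => g (Fin.insertNth i 1 s)) ∧
      rB.domain = soloInformedCube m ∧ (rB.integrand = fun s => g (Fin.insertNth i 0 s)) ∧
      of rD - (of rT - of rB) ∈ relations := by
  have hC := isSemialgebraic_soloInformedCube (m + 1)
  have hC' := isSemialgebraic_soloInformedCube m
  have hd : ∀ z ∈ W, DifferentiableAt ℝ g z := fun z hz =>
    (hgd.differentiableOn one_ne_zero z hz).differentiableAt (hW.mem_nhds hz)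
  have hgsC : IsSemialgebraicFunOn ℚ (soloInformedCube (m + 1)) g := hgs.mono hCW hC
  have hfib : ∀ s ∈ soloInformedCube m, ∀ t ∈ Icc (0 : ℝ) 1,
      (Fin.insertNth i t s : Fin (m + 1) → ℝ) ∈ soloInformedCube (m + 1) :=
    fun s hs t ht => soloInformed_insertNth_mem_cube i hs ht.1 ht.2
  have hDs : IsSemialgebraicFunOn ℚ (soloInformedCube (m + 1))
      (fun z => fderiv ℝ g z (Pi.single i 1)) := (hgs.fderiv_apply_single hW hd i).mono hCW hC
  have hDc : ContinuousOn (fun z => fderiv ℝ g z (Pi.single i 1)) (soloInformedCube (m + 1)) :=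
    ((hgd.continuousOn_fderiv_of_isOpen hW le_rfl).clm_apply continuousOn_const).mono hCW
  have hTs : IsSemialgebraicFunOn ℚ (soloInformedCube m) (fun s => g (Fin.insertNth i 1 s)) :=
    IsSemialgebraicFunOn.comp_isSemialgebraicMapOn_holds hgsC
      (soloInformed_isSemialgebraicMapOn_insertNth_one hC' i)
      fun s hs => hfib s hs 1 ⟨zero_le_one, le_rfl⟩
  have hTc : ContinuousOn (fun s => g (Fin.insertNth i 1 s)) (soloInformedCube m) :=
    hgd.continuousOn.comp (soloInformed_continuous_insertNth_const i 1).continuousOn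
      fun s hs => hCW (hfib s hs 1 ⟨zero_le_one, le_rfl⟩)
  have hBs : IsSemialgebraicFunOn ℚ (soloInformedCube m) (fun s => g (Fin.insertNth i 0 s)) :=
    IsSemialgebraicFunOn.comp_isSemialgebraicMapOn_holds hgsC
      (soloInformed_isSemialgebraicMapOn_insertNth_zero hC' i)
      fun s hs => hfib s hs 0 ⟨le_rfl, zero_le_one⟩
  have hBc : ContinuousOn (fun s => g (Fin.insertNth i 0 s)) (soloInformedCube m) :=
    hgd.continuousOn.comp (soloInformed_continuous_insertNth_const i 0).continuousOn
      fun s hs => hCW (hfib s hs 0 ⟨le_rfl, zero_le_one⟩)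
  exact ⟨soloInformedCubeRep (m + 1) _ hDs hDc, soloInformedCubeRep m _ hTs hTc,
    soloInformedCubeRep m _ hBs hBc, rfl, rfl, rfl, rfl, rfl, rfl,
    soloInformed_kzStokes_cube hW hCW hgs hgd i _ rfl (fun _ _ => rfl) _ _ rfl rfl
      (fun _ _ => rfl) (fun _ _ => rfl)⟩

/-! ### Ayoub's compatibility generator is a KZ relation -/

/-- **Reading an `n`-variable integrand on `[0,1]ⁿ⁺¹` is a KZ relation**: if `r = [[0,1]ⁿ⁺¹, f ∘ init]`
and `r' = [[0,1]ⁿ, f]` then `[r] − [r'] ∈ KZ.relations` — one Newton–Leibniz move with the primitive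
`F(x, t) = t · f(x)` along the last coordinate.  No regularity of `f` beyond admissibility is used.
[Ayoub 2014, §2.2; Kontsevich–Zagier 2001, §1.2 rule (3)] -/
theorem soloInformed_of_sub_of_comp_init_mem_relations {n : ℕ} (r : IntegralRep (n + 1))
    (r' : IntegralRep n) (hr : r.domain = soloInformedCube (n + 1))
    (hr' : r'.domain = soloInformedCube n)
    (h : EqOn r.integrand (fun z => r'.integrand (Fin.init z)) (soloInformedCube (n + 1))) :
    of r - of r' ∈ relations := by
  have hC := isSemialgebraic_soloInformedCube (n + 1)
  have hinit : IsSemialgebraicMapOn ℚ (soloInformedCube (n + 1))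
      (fun z : Fin (n + 1) → ℝ => Fin.init z) :=
    IsSemialgebraicMapOn.of_forall hC fun j => isSemialgebraicFunOn_apply hC j.castSucc
  have hmaps : MapsTo (fun z : Fin (n + 1) → ℝ => Fin.init z) (soloInformedCube (n + 1))
      r'.domain := fun z hz => by
    rw [hr']
    exact ((soloInformedCube_succ_eq_band n).le hz).1
  have hF : IsSemialgebraicFunOn ℚ (soloInformedCube (n + 1))
      (fun z => z (Fin.last n) * r'.integrand (Fin.init z)) :=
    IsSemialgebraicFunOn.mul_holds (isSemialgebraicFunOn_apply hC (Fin.last n))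
      (IsSemialgebraicFunOn.comp_isSemialgebraicMapOn_holds r'.isSemialgebraicFunOn_integrand
        hinit hmaps)
  have hmem : ∀ x ∈ soloInformedCube n, ∀ t ∈ Icc (0 : ℝ) 1,
      (Fin.snoc x t : Fin (n + 1) → ℝ) ∈ soloInformedCube (n + 1) := fun x hx t ht => by
    rw [soloInformedCube_succ_eq_band]
    exact ⟨by simpa using hx, by simpa using ht.1, by simpa using ht.2⟩
  refine newtonLeibnizRel_subset_relations ⟨n, r, r', fun _ => 0, fun _ => 1,
    fun z => z (Fin.last n) * r'.integrand (Fin.init z), by rw [hr]; exact hF, ?_, ?_,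
    fun _ _ => zero_le_one, by rw [hr, hr']; exact soloInformedCube_succ_eq_band n, ?_, ?_, ?_, rfl⟩
  · exact (by simpa using isSemialgebraicFunOn_ratCast r'.isSemialgebraic_domain 0 :
      IsSemialgebraicFunOn ℚ r'.domain fun _ : Fin n → ℝ => (0 : ℝ))
  · exact (by simpa using isSemialgebraicFunOn_ratCast r'.isSemialgebraic_domain 1 :
      IsSemialgebraicFunOn ℚ r'.domain fun _ : Fin n → ℝ => (1 : ℝ))
  · intro x _
    show ContinuousOn (fun t : ℝ => (Fin.snoc x t : Fin (n + 1) → ℝ) (Fin.last n) *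
      r'.integrand (Fin.init (Fin.snoc x t : Fin (n + 1) → ℝ))) (Icc 0 1)
    simp only [Fin.snoc_last, Fin.init_snoc]
    exact (continuous_id.mul continuous_const).continuousOn
  · intro x hx t ht
    have hx' : x ∈ soloInformedCube n := by rw [← hr']; exact hx
    have ht' : t ∈ Ioo (0 : ℝ) 1 := ht
    show HasDerivAt (fun s : ℝ => (Fin.snoc x s : Fin (n + 1) → ℝ) (Fin.last n) *
      r'.integrand (Fin.init (Fin.snoc x s : Fin (n + 1) → ℝ))) (r.integrand (Fin.snoc x t)) t
    rw [h (hmem x hx' t (Ioo_subset_Icc_self ht'))]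
    simp only [Fin.snoc_last, Fin.init_snoc]
    simpa using (hasDerivAt_id t).mul_const (r'.integrand x)
  · intro x _
    show r'.integrand x = (Fin.snoc x (1 : ℝ) : Fin (n + 1) → ℝ) (Fin.last n) *
        r'.integrand (Fin.init (Fin.snoc x (1 : ℝ) : Fin (n + 1) → ℝ)) -
      (Fin.snoc x (0 : ℝ) : Fin (n + 1) → ℝ) (Fin.last n) *
        r'.integrand (Fin.init (Fin.snoc x (0 : ℝ) : Fin (n + 1) → ℝ))
    simp only [Fin.snoc_last, Fin.init_snoc]
    ring

end Summit.KontsevichZagierPeriods.KontsevichZagierPeriods.Theorems
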